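import Summits.HubbardSuperconductivity.HubbardSuperconductivity.Theorems.FunctionFieldCertificateAssemblyFejerGlue
import Summits.HubbardSuperconductivity.HubbardSuperconductivity.Theorems.FunctionFieldCertificateMesoscopicPairOrderBlochAbstract
import Summits.HubbardSuperconductivity.HubbardSuperconductivity.Theorems.WindowGap.Negative.PairModesAtMomentum
import Literature.MathematicalPhysics.QuantumLattice.BlockPairPlancherel
import Literature.Barriers.HubbardSuperconductivity.PureModelStripeCompetitionProofs
import HarnessLib

/-!
# Crux `MesoscopicPairOrder` (item `stmt-HubbardSuperconductivity-7331`): a flat pair structure factor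
# kills the crux body — the interaction `0 < U` is load-bearing (free Fermi gas)

Negative-side lemmas for the crux of route `FunctionFieldCertificate` (pole-free half: at ONE `(U, δ)`
a margin `m R² ≤ T_R(ψ)/L²` for the Fejér-box pair functional
`T_R(ψ) = Σ_{x,y} Πᵢ (1 - |(y-x)ᵢ|_L/R)₊ Re⟨P_x ψ, P_y ψ⟩`, `P_x = localPair dWaveFormFactor L x`, at
arbitrarily large scales `R`, in EVERY normalised `(2⌊(1-δ)L²/2⌋, S^z = 0)`-sector ground state of
`hubbardTorus 2 L 1 U`, all large even `L`), written by the line's lead (c4). No definition is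
introduced; the crux body at fixed `(U, δ)` is spelled out verbatim, as in the sibling files
`LoadBearing.lean`, `SaturatedExclusion.lean`, `Ceiling.lean`.

* `boxSum_le_of_forall_pairStructureFactor_le` — **flat structure factor ⇒ no mesoscopic order**:
  for every Fock vector `ψ`, `0 < R`, `2R ≤ L`: if the pair structure factor
  `S_ψ(m) = ‖Δ_d(m)ψ‖²/L²` (`pairStructureFactor`) is `≤ B` at EVERY momentum `m`, then
  `T_R(ψ) ≤ B · L²`, i.e. `T_R/(R²L²) ≤ B/R²` (tent identity `Σ_a ‖B_a ψ‖² = R² T_R(ψ)` of the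
  Assembly file + block Plancherel `re_sum_star_block_mulVec_le_of_forall_mode_le` of
  `Literature/…/BlockPairPlancherel.lean`). The Fejér box at scale `R` sees exactly a pair mode with
  `S_ψ(m) ≥ m R²`: a NECESSARY condition for the crux at its witness `(U, δ)` is that the pair
  structure factors of sector ground states are NOT bounded uniformly in `L`
  (`pointwise_false_of_frequently_flat_groundState`; dually
  `eventually_exists_large_mode_of_pointwise`: for every `B`, eventually every normalised sector
  ground state has a pair mode with `S_ψ(m) > B`). A refutation at `(U, δ)` needs only ONE normalised
  sector ground state with a bounded ("normal-metal") pair structure factor infinitely often.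
* `exists_joint_eigenvector_mem` — a commuting finite family of matrices has a joint eigenvector in
  every nonzero jointly invariant subspace (induction on the family over `exists_eigenvector_mem`).
* `exists_unit_flat_groundState_free` — **the free Fermi gas is flat**: at `U = 0`, `L ≥ 3`, every
  sector `(2n, 0)` with `n ≤ L²` has a NORMALISED GROUND STATE `ψ` with `S_ψ(m) ≤ 50` at every `m`
  (a joint eigenvector of the Bloch occupation numbers inside the sector ground eigenspace — a
  plane-wave Slater determinant — to which the per-momentum free bound
  `WindowGap.Negative.re_trace_mul_conjTranspose_pairFieldAt_dWave_mul_le` applies with the rank-one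
  weight `P = ψψᴴ`).
* `pointwise_false_at_zero_coupling` — hence **the crux body with `U := 0` is FALSE at every filling
  `δ ≥ -1`** (so on the whole range `(0, 1/2)`): at scale `R` with `m R² > 50` the flat free ground
  state violates `m R² ≤ T_R(ψ)/L² ≤ 50`. The clause `0 < U` of `MesoscopicPairOrder` is load-bearing
  (as are the ground-state and normalisation clauses, `LoadBearing.lean`), and the cards' free-gas
  calibration of the crux functional (`t_R ≈ 0.9 S_free(0)/R²`, numerics) is a theorem uniform in `L`:
  margin `≤ 50/R²`, no logarithm. Nothing here refutes the crux (`∃ U > 0 …`).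

Sources: J. Bardeen, L. N. Cooper, J. R. Schrieffer, Phys. Rev. 108 (1957) 1175, §II (pair
correlations of the normal Fermi sea are `O(1)` per mode); C. N. Yang, Rev. Mod. Phys. 34 (1962)
694, §3; T. Kennedy, E. H. Lieb, B. S. Shastry, PRL 61 (1988) 2582 (Parseval bookkeeping);
D. J. Scalapino, Phys. Rep. 250 (1995) 329, §2. Folklore finite-dimensional statements.
-/

noncomputable section

-- the summit namespace repeats the problem name by design (D-0017)
set_option linter.dupNamespace false

namespace Summit.HubbardSuperconductivity.HubbardSuperconductivity.Theorems.MesoscopicPairOrder.Negative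

open Matrix Finset Filter
open Literature.Probability.LatticeModels Literature.MathematicalPhysics.QuantumLattice
open scoped ComplexOrder ComplexConjugate

/-! ### Flat pair structure factor ⇒ no mesoscopic pair order -/

/-- **Flat structure factor ⇒ the Fejér-box functional is `O(L²)`.** For every Fock vector `ψ` of the
fermionic torus of side `L`, every block scale `0 < R` with `2R ≤ L` and every bound `B`: if
`S_ψ(m) = pairStructureFactor dWaveFormFactor L ψ m ≤ B` at EVERY momentum label `m`, then
`T_R(ψ) ≤ B · L²` (tent identity `R² T_R(ψ) = Σ_a ‖B_a ψ‖²` and block Plancherel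
`Σ_a ‖B_a ψ‖² ≤ (sup_m ‖Δ_d(m)ψ‖²) · R²`). Kennedy–Lieb–Shastry, PRL 61 (1988) 2582;
Stein–Shakarchi, *Fourier Analysis*, Ch. 2. [folklore] -/
theorem boxSum_le_of_forall_pairStructureFactor_le (L : ℕ) [NeZero L] (R : ℕ) (hR : 0 < R)
    (hRL : 2 * R ≤ L) (ψ : Fock (Orb (FermionTorus 2 L))) {B : ℝ}
    (hB : ∀ m : TorusSite 2 L, pairStructureFactor dWaveFormFactor L ψ m ≤ B) :
    (∑ x : TorusSite 2 L, ∑ y : TorusSite 2 L,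
        (∏ i : Fin 2, max 0 (1 - |(((y i - x i).valMinAbs : ℤ) : ℝ)| / (R : ℝ))) *
          (star (localPair dWaveFormFactor L x *ᵥ ψ) ⬝ᵥ (localPair dWaveFormFactor L y *ᵥ ψ)).re) ≤
      B * (L : ℝ) ^ 2 := by
  have hLpos : (0 : ℝ) < L := Nat.cast_pos.2 (Nat.pos_of_ne_zero (NeZero.ne L))
  have hL2 : (0 : ℝ) < (L : ℝ) ^ 2 := by positivity
  have hRpos : (0 : ℝ) < R := Nat.cast_pos.2 hR
  have hR2 : (0 : ℝ) < (R : ℝ) ^ 2 := by positivity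
  -- the structure-factor bound, unnormalised: `‖Δ_d(m) ψ‖² ≤ B L²`
  have hS : ∀ m : TorusSite 2 L,
      (star (pairFieldAt dWaveFormFactor L m *ᵥ ψ) ⬝ᵥ (pairFieldAt dWaveFormFactor L m *ᵥ ψ)).re ≤
        B * (L : ℝ) ^ 2 := by
    intro m
    have h := hB m
    rw [pairStructureFactor_apply, div_le_iff₀ hL2] at h
    exact h
  -- block Plancherel and the tent identity
  have hblock := re_sum_star_block_mulVec_le_of_forall_mode_le dWaveFormFactor ψ hS R (by omega)
  rw [FunctionFieldCertificateAssembly.re_sum_star_blockMulVec_dotProduct_eq R hR hRL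
    (localPair dWaveFormFactor L) ψ] at hblock
  have key : (R : ℝ) ^ 2 * (∑ x : TorusSite 2 L, ∑ y : TorusSite 2 L,
      (∏ i : Fin 2, max 0 (1 - |(((y i - x i).valMinAbs : ℤ) : ℝ)| / (R : ℝ))) *
        (star (localPair dWaveFormFactor L x *ᵥ ψ) ⬝ᵥ (localPair dWaveFormFactor L y *ᵥ ψ)).re) ≤
      (R : ℝ) ^ 2 * (B * (L : ℝ) ^ 2) := by
    calc _ ≤ B * (L : ℝ) ^ 2 * (R : ℝ) ^ 2 := hblock
      _ = (R : ℝ) ^ 2 * (B * (L : ℝ) ^ 2) := by ring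
  exact le_of_mul_le_mul_left key hR2

/-- **Mesoscopic pair order needs unbounded pair structure factors (pointwise kill criterion).** If at
`(U, δ)` there is a bound `B` such that for infinitely many even `L` SOME normalised
`(2⌊(1-δ)L²/2⌋, S^z = 0)`-sector ground state of `hubbardTorus 2 L 1 U` has pair structure factor
`S_ψ(m) ≤ B` at every momentum `m`, then the crux body fails at `(U, δ)`: at the scale `R ≥ R₀`,
`R₀ = ⌈B/m⌉ + 1`, that the crux must supply, such a state has `T_R(ψ)/L² ≤ B < m R²`
(`boxSum_le_of_forall_pairStructureFactor_le`). So the witness `(U, δ)` of any proof is a point where,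
for every `B`, eventually EVERY sector ground state carries a pair mode with `S_ψ(m) > B`
(`eventually_exists_large_mode_of_pointwise`); a refuter needs one "normal" ground state i.o.
Kennedy–Lieb–Shastry, PRL 61 (1988) 2582; Yang (1962) §3. [folklore] -/
theorem pointwise_false_of_frequently_flat_groundState {U δ : ℝ}
    (hflat : ∃ B : ℝ, ∃ᶠ L : ℕ in atTop, ∃ _ : NeZero L, Even L ∧ ∃ ψ : Fock (Orb (FermionTorus 2 L)),
      star ψ ⬝ᵥ ψ = 1 ∧
        IsGroundStateInSector (hubbardTorus 2 L 1 U) (2 * ⌊(1 - δ) * (L : ℝ) ^ 2 / 2⌋₊) 0 ψ ∧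
          ∀ m : TorusSite 2 L, pairStructureFactor dWaveFormFactor L ψ m ≤ B) :
    ¬ (∃ m : ℝ, 0 < m ∧ ∀ R₀ : ℕ, ∃ R : ℕ, R₀ ≤ R ∧ ∃ L₀ : ℕ, ∀ (L : ℕ) [NeZero L], L₀ ≤ L → Even L →
        ∀ ψ : Fock (Orb (FermionTorus 2 L)), star ψ ⬝ᵥ ψ = 1 →
          IsGroundStateInSector (hubbardTorus 2 L 1 U) (2 * ⌊(1 - δ) * (L : ℝ) ^ 2 / 2⌋₊) 0 ψ →
            m * (R : ℝ) ^ 2 ≤ (∑ x : TorusSite 2 L, ∑ y : TorusSite 2 L,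
                  (∏ i : Fin 2, max 0 (1 - |(((y i - x i).valMinAbs : ℤ) : ℝ)| / (R : ℝ))) *
                    (star (localPair dWaveFormFactor L x *ᵥ ψ) ⬝ᵥ (localPair dWaveFormFactor L y *ᵥ ψ)).re) / (L : ℝ) ^ 2) := by
  rintro ⟨m, hm, hall⟩
  obtain ⟨B, hfreq⟩ := hflat
  -- the scale: `R ≥ R₀ = ⌈B/m⌉ + 1`, so that `B < m R ≤ m R²`
  obtain ⟨R, hR₀, L₀, hL⟩ := hall (⌈B / m⌉₊ + 1)
  have hR1 : 1 ≤ R := le_trans (Nat.le_add_left 1 _) hR₀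
  have hRpos : 0 < R := hR1
  have hBR : B < m * (R : ℝ) := by
    have h1 : B / m ≤ (⌈B / m⌉₊ : ℝ) := Nat.le_ceil _
    have h2 : (⌈B / m⌉₊ : ℝ) + 1 ≤ (R : ℝ) := by exact_mod_cast hR₀
    have h3 : B / m < (R : ℝ) := by linarith
    rwa [div_lt_iff₀ hm, mul_comm] at h3
  have hBR2 : B < m * (R : ℝ) ^ 2 := by
    have hR1' : (1 : ℝ) ≤ R := by exact_mod_cast hR1
    have : m * (R : ℝ) ≤ m * (R : ℝ) ^ 2 := by
      rw [sq]
      exact mul_le_mul_of_nonneg_left (le_mul_of_one_le_left (by positivity) hR1') hm.le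
    linarith
  -- a good side: even, `≥ L₀`, `≥ 2R`, carrying a flat normalised ground state
  obtain ⟨L, ⟨hL0, hEven, ψ, hψ1, hgs, hflatψ⟩, hLge⟩ :=
    (hfreq.and_eventually (eventually_ge_atTop (max L₀ (2 * R)))).exists
  have hLL₀ : L₀ ≤ L := le_of_max_le_left hLge
  have h2R : 2 * R ≤ L := le_of_max_le_right hLge
  have hLpos : (0 : ℝ) < L := Nat.cast_pos.2 (Nat.pos_of_ne_zero (NeZero.ne L))
  have hL2 : (0 : ℝ) < (L : ℝ) ^ 2 := by positivity
  have hbody := hL L hLL₀ hEven ψ hψ1 hgs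
  have hceil := boxSum_le_of_forall_pairStructureFactor_le L R hRpos h2R ψ hflatψ
  rw [le_div_iff₀ hL2] at hbody
  have : m * (R : ℝ) ^ 2 * (L : ℝ) ^ 2 ≤ B * (L : ℝ) ^ 2 := hbody.trans hceil
  have hmB : m * (R : ℝ) ^ 2 ≤ B := le_of_mul_le_mul_right this hL2
  linarith

/-- Dual form: **where the crux body holds, for every bound `B`, eventually (along even sides) every
normalised sector ground state has a pair mode with structure factor above `B`** — the Fejér box
forces unbounded (in `L`, uniformly over ground states) pair structure factors at the witness
`(U, δ)`: a condensate at `k = 0` or macroscopically soft pair modes nearby. [folklore] -/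
theorem eventually_exists_large_mode_of_pointwise {U δ : ℝ}
    (h : ∃ m : ℝ, 0 < m ∧ ∀ R₀ : ℕ, ∃ R : ℕ, R₀ ≤ R ∧ ∃ L₀ : ℕ, ∀ (L : ℕ) [NeZero L], L₀ ≤ L → Even L →
        ∀ ψ : Fock (Orb (FermionTorus 2 L)), star ψ ⬝ᵥ ψ = 1 →
          IsGroundStateInSector (hubbardTorus 2 L 1 U) (2 * ⌊(1 - δ) * (L : ℝ) ^ 2 / 2⌋₊) 0 ψ →
            m * (R : ℝ) ^ 2 ≤ (∑ x : TorusSite 2 L, ∑ y : TorusSite 2 L,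
                  (∏ i : Fin 2, max 0 (1 - |(((y i - x i).valMinAbs : ℤ) : ℝ)| / (R : ℝ))) *
                    (star (localPair dWaveFormFactor L x *ᵥ ψ) ⬝ᵥ (localPair dWaveFormFactor L y *ᵥ ψ)).re) / (L : ℝ) ^ 2)
    (B : ℝ) :
    ∀ᶠ L : ℕ in atTop, ∀ [NeZero L], Even L → ∀ ψ : Fock (Orb (FermionTorus 2 L)), star ψ ⬝ᵥ ψ = 1 →
      IsGroundStateInSector (hubbardTorus 2 L 1 U) (2 * ⌊(1 - δ) * (L : ℝ) ^ 2 / 2⌋₊) 0 ψ →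
        ∃ m : TorusSite 2 L, B < pairStructureFactor dWaveFormFactor L ψ m := by
  have hns := mt (pointwise_false_of_frequently_flat_groundState (U := U) (δ := δ)) (not_not.2 h)
  push Not at hns
  exact hns B

/-! ### A commuting family has a joint eigenvector in every jointly invariant subspace -/

/-- **A commuting finite family of matrices has a joint eigenvector in every nonzero jointly
invariant subspace** (over `ℂ`): induction on the family — an eigenvector of the new matrix exists in
the subspace (`FunctionFieldCertificate.exists_eigenvector_mem`), its eigenspace inside the subspace
is nonzero and invariant under the rest (commutation), recurse there. Simultaneous
diagonalisation; Horn–Johnson, *Matrix Analysis*, Thm 1.3.19. [folklore] -/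
theorem exists_joint_eigenvector_mem {n ι : Type*} [Fintype n] [DecidableEq n] (s : Finset ι)
    (T : ι → Matrix n n ℂ) (hcomm : ∀ i j, Commute (T i) (T j)) :
    ∀ (W : Submodule ℂ (n → ℂ)), W ≠ ⊥ → (∀ i ∈ s, ∀ w ∈ W, T i *ᵥ w ∈ W) →
      ∃ w ∈ W, w ≠ 0 ∧ ∀ i ∈ s, ∃ c : ℂ, T i *ᵥ w = c • w := by
  classical
  induction s using Finset.induction_on with
  | empty =>
      intro W hW _
      obtain ⟨w, hw, hw0⟩ := Submodule.exists_mem_ne_zero_of_ne_bot hW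
      exact ⟨w, hw, hw0, fun i hi => absurd hi (Finset.notMem_empty i)⟩
  | insert a s ha ih =>
      intro W hW hinv
      -- an eigenvector of `T a` inside `W`, and its eigenspace inside `W`
      obtain ⟨v, hvW, hv0, c, hvc⟩ := FunctionFieldCertificate.exists_eigenvector_mem (T a) W hW
        (hinv a (Finset.mem_insert_self a s))
      set W' : Submodule ℂ (n → ℂ) := W ⊓ Module.End.eigenspace (Matrix.toLin' (T a)) c with hW'
      have hmem : ∀ w : n → ℂ, w ∈ W' ↔ w ∈ W ∧ T a *ᵥ w = c • w := fun w => by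
        rw [hW', Submodule.mem_inf, Module.End.mem_eigenspace_iff, Matrix.toLin'_apply]
      have hW'ne : W' ≠ ⊥ := by
        intro h
        have : v ∈ W' := (hmem v).2 ⟨hvW, hvc⟩
        rw [h, Submodule.mem_bot] at this
        exact hv0 this
      have hinv' : ∀ i ∈ s, ∀ w ∈ W', T i *ᵥ w ∈ W' := by
        intro i hi w hw
        obtain ⟨hwW, hwc⟩ := (hmem w).1 hw
        refine (hmem _).2 ⟨hinv i (Finset.mem_insert_of_mem hi) w hwW, ?_⟩
        rw [mulVec_mulVec, (hcomm a i).eq, ← mulVec_mulVec, hwc, mulVec_smul]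
      obtain ⟨w, hwW', hw0, hw⟩ := ih W' hW'ne hinv'
      obtain ⟨hwW, hwc⟩ := (hmem w).1 hwW'
      refine ⟨w, hwW, hw0, fun i hi => ?_⟩
      rcases Finset.mem_insert.1 hi with rfl | hi
      · exact ⟨c, hwc⟩
      · exact hw i hi

/-! ### Rank-one weights of joint eigenvectors -/

section RankOne

variable {n : Type*} [Fintype n]

/-- An eigenvalue of a Hermitian matrix attached to a NONZERO eigenvector is real. [folklore] -/
theorem star_eq_self_of_eigen {N : Matrix n n ℂ} (hN : Nᴴ = N) {ψ : n → ℂ} (hψ : ψ ≠ 0) {c : ℂ}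
    (h : N *ᵥ ψ = c • ψ) : star c = c := by
  have hpos : 0 < star ψ ⬝ᵥ ψ := dotProduct_star_self_pos_iff.2 hψ
  have hne : star ψ ⬝ᵥ ψ ≠ 0 := ne_of_gt hpos
  have h1 : star ψ ⬝ᵥ N *ᵥ ψ = c * (star ψ ⬝ᵥ ψ) := by rw [h, dotProduct_smul, smul_eq_mul]
  have h2 : star (star ψ ⬝ᵥ N *ᵥ ψ) = star ψ ⬝ᵥ N *ᵥ ψ := by
    rw [← star_dotProduct_star, star_star, star_mulVec, hN, ← dotProduct_mulVec]
  have h3 : star (star ψ ⬝ᵥ ψ) = star ψ ⬝ᵥ ψ := (star_dotProduct ψ ψ).symm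
  rw [h1, star_mul', h3] at h2
  exact mul_right_cancel₀ hne h2

/-- **The rank-one weight of a unit joint eigenvector commutes with the family.** For a unit vector
`ψ` (`star ψ ⬝ᵥ ψ = 1`) and a Hermitian `N` with `N ψ = c ψ`: `P = ψ ψᴴ = vecMulVec ψ (star ψ)` is a
Hermitian idempotent with `tr (P A) = ⟨ψ, A ψ⟩`, and `[P, N] = 0` (`c` is real). [folklore] -/
theorem vecMulVec_commute_of_eigen {N : Matrix n n ℂ} (hN : Nᴴ = N) {ψ : n → ℂ}
    (hψ1 : star ψ ⬝ᵥ ψ = 1) {c : ℂ} (h : N *ᵥ ψ = c • ψ) :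
    Commute (vecMulVec ψ (star ψ)) N := by
  have hψ0 : ψ ≠ 0 := by
    rintro rfl
    simp at hψ1
  have hc : star c = c := star_eq_self_of_eigen hN hψ0 h
  change vecMulVec ψ (star ψ) * N = N * vecMulVec ψ (star ψ)
  rw [vecMulVec_mul, mul_vecMulVec, h]
  have hrow : star ψ ᵥ* N = star (N *ᵥ ψ) := by
    rw [star_mulVec, hN]
  rw [hrow, h, star_smul, hc]
  ext i j
  simp only [vecMulVec_apply, Pi.smul_apply, smul_eq_mul]
  ring

/-- For a unit vector, `ψψᴴ` is a Hermitian idempotent of trace one with `tr (ψψᴴ A) = ⟨ψ, A ψ⟩`.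
[folklore] -/
theorem vecMulVec_unit_props {ψ : n → ℂ} (hψ1 : star ψ ⬝ᵥ ψ = 1) :
    (vecMulVec ψ (star ψ))ᴴ = vecMulVec ψ (star ψ) ∧
      vecMulVec ψ (star ψ) * vecMulVec ψ (star ψ) = vecMulVec ψ (star ψ) ∧
        (vecMulVec ψ (star ψ)).trace = 1 ∧
          ∀ A : Matrix n n ℂ, (vecMulVec ψ (star ψ) * A).trace = star ψ ⬝ᵥ A *ᵥ ψ := by
  refine ⟨?_, ?_, ?_, ?_⟩
  · rw [conjTranspose_vecMulVec, star_star]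
  · rw [vecMulVec_mul_vecMulVec, hψ1, one_smul]
  · rw [trace_vecMulVec, dotProduct_comm, hψ1]
  · intro A
    rw [vecMulVec_mul, trace_vecMulVec, dotProduct_comm, ← dotProduct_mulVec]

end RankOne

/-! ### The free Fermi gas: a normalised sector ground state with flat pair structure factor -/

/-- **The free Fermi gas is flat.** At `U = 0` (`t = 1`), `L ≥ 3`, for every `n ≤ L²` the sector
`(2n, S^z = 0)` of `hubbardTorus 2 L 1 0` has a NORMALISED GROUND STATE `ψ` whose `d`-wave pair
structure factor is bounded at every momentum: `S_ψ(m) = ‖Δ_d(m)ψ‖²/L² ≤ 50` for all `m`. Take a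
joint eigenvector of the (commuting, sector- and `H(1,0)`-preserving) Bloch occupation numbers
`n_{kσ}` inside the sector ground eigenspace (`exists_joint_eigenvector_mem`,
`momentumNumber_mulVec_mem_sectorEigenspace_free`, ground states exist by
`exists_unit_isGroundStateInSector_hubbardTorus`), normalise it, and apply the per-momentum free bound
`WindowGap.Negative.re_trace_mul_conjTranspose_pairFieldAt_dWave_mul_le` to the rank-one weight `ψψᴴ`
(trace one, commuting with every `n_{kσ}`). Bardeen–Cooper–Schrieffer (1957) §II; Yang (1962) §3.
[folklore] -/
theorem exists_unit_flat_groundState_free (L : ℕ) [NeZero L] (hL : 3 ≤ L) (n : ℕ) (hn : n ≤ L ^ 2) :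
    ∃ ψ : Fock (Orb (FermionTorus 2 L)), star ψ ⬝ᵥ ψ = 1 ∧
      IsGroundStateInSector (hubbardTorus 2 L 1 0) (2 * n) 0 ψ ∧
        ∀ m : TorusSite 2 L, pairStructureFactor dWaveFormFactor L ψ m ≤ 50 := by
  classical
  set H := hubbardTorus 2 L 1 0 with hH
  set K : Submodule ℂ (Fock (Orb (FermionTorus 2 L))) := szSector (2 * n) 0 ⊓
    Module.End.eigenspace (Matrix.toLin' H) ((H.minEnergyOn (szSector (2 * n) 0) : ℝ) : ℂ) with hK
  have hmemK : ∀ φ : Fock (Orb (FermionTorus 2 L)), φ ∈ K ↔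
      φ ∈ szSector (Λ := FermionTorus 2 L) (2 * n) 0 ∧
        H *ᵥ φ = ((H.minEnergyOn (szSector (2 * n) 0) : ℝ) : ℂ) • φ := fun φ => by
    rw [hK, Submodule.mem_inf, Module.End.mem_eigenspace_iff, Matrix.toLin'_apply]
  -- `K ≠ ⊥`: sector ground states exist
  obtain ⟨φ₀, -, hφ₀⟩ :=
    Literature.Barriers.HubbardSuperconductivity.exists_unit_isGroundStateInSector_hubbardTorus 0 L n hn
  have hKne : K ≠ ⊥ := by
    intro h
    have : φ₀ ∈ K := (hmemK φ₀).2 ⟨hφ₀.1, hφ₀.2.2⟩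
    rw [h, Submodule.mem_bot] at this
    exact hφ₀.2.1 this
  -- a joint eigenvector of all `n_{kσ}` in `K`
  set T : TorusSite 2 L × Fin 2 → Matrix (Finset (Orb (FermionTorus 2 L))) (Finset (Orb (FermionTorus 2 L))) ℂ :=
    fun p => momentumNumber p.1 p.2 with hT
  have hcomm : ∀ p q : TorusSite 2 L × Fin 2, Commute (T p) (T q) :=
    fun p q => momentumNumber_commute p.1 q.1 p.2 q.2
  have hinv : ∀ p ∈ (Finset.univ : Finset (TorusSite 2 L × Fin 2)), ∀ w ∈ K, T p *ᵥ w ∈ K := by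
    intro p _ w hw
    have hw' := momentumNumber_mulVec_mem_sectorEigenspace_free hL p.1 p.2 (2 * n) 0
      ((H.minEnergyOn (szSector (2 * n) 0) : ℝ) : ℂ) (v := w) (by rw [hK] at hw; exact hw)
    rw [hK]
    exact hw'
  obtain ⟨w, hwK, hw0, hw⟩ := exists_joint_eigenvector_mem Finset.univ T hcomm K hKne hinv
  -- normalise
  obtain ⟨c, hc0, hc1⟩ := Literature.MathematicalPhysics.QuantumLattice.exists_smul_unit hw0
  set ψ := c • w with hψ
  have hψK : ψ ∈ K := Submodule.smul_mem K c hwK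
  have hψ0 : ψ ≠ 0 := by
    rintro h0
    rw [h0] at hc1
    simp at hc1
  obtain ⟨hψsec, hψeig⟩ := (hmemK ψ).1 hψK
  have hgs : IsGroundStateInSector H (2 * n) 0 ψ := ⟨hψsec, hψ0, hψeig⟩
  have heig : ∀ (k : TorusSite 2 L) (σ : Fin 2), ∃ e : ℂ, momentumNumber k σ *ᵥ ψ = e • ψ := by
    intro k σ
    obtain ⟨e, he⟩ := hw (k, σ) (Finset.mem_univ _)
    have he' : momentumNumber k σ *ᵥ w = e • w := he
    exact ⟨e, by rw [hψ, mulVec_smul, he', smul_comm]⟩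
  -- the rank-one weight
  obtain ⟨hPh, hPP, hP1, hPA⟩ := vecMulVec_unit_props hc1
  have hPc : ∀ (k : TorusSite 2 L) (σ : Fin 2), Commute (vecMulVec ψ (star ψ)) (momentumNumber k σ) := by
    intro k σ
    obtain ⟨e, he⟩ := heig k σ
    exact vecMulVec_commute_of_eigen (momentumNumber_conjTranspose k σ) hc1 he
  refine ⟨ψ, hc1, hgs, fun m => ?_⟩
  have hfree := WindowGap.Negative.re_trace_mul_conjTranspose_pairFieldAt_dWave_mul_le hPh hPP hPc m
  rw [hPA, hP1, Complex.one_re, mul_one, ← star_mulVec_dotProduct_mulVec] at hfree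
  have hLpos : (0 : ℝ) < L := Nat.cast_pos.2 (Nat.pos_of_ne_zero (NeZero.ne L))
  have hL2 : (0 : ℝ) < (L : ℝ) ^ 2 := by positivity
  rw [pairStructureFactor_apply, div_le_iff₀ hL2]
  exact hfree

/-- **The clause `0 < U` is load-bearing: at `U = 0` the crux body is FALSE at every filling
`δ ≥ -1`** (so throughout the summit's range `δ ∈ (0, 1/2)`). The free Fermi gas has, on every torus
of side `L ≥ 3`, a normalised sector ground state with flat pair structure factor `S_ψ ≤ 50`
(`exists_unit_flat_groundState_free`), hence `T_R(ψ)/L² ≤ 50 < m R²` at the scale the crux must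
supply (`pointwise_false_of_frequently_flat_groundState`). Calibration of the crux functional at the
free point, uniform in `L`: margin `≤ 50/R²` (the cards' numerics `t_R ≈ 0.9 S_free(0)/R²`), no
logarithm. Nothing here refutes the crux, which asks for a witness with `U > 0`.
Bardeen–Cooper–Schrieffer (1957) §II; Yang (1962) §3. [folklore] -/
theorem pointwise_false_at_zero_coupling {δ : ℝ} (hδ : -1 ≤ δ) :
    ¬ (∃ m : ℝ, 0 < m ∧ ∀ R₀ : ℕ, ∃ R : ℕ, R₀ ≤ R ∧ ∃ L₀ : ℕ, ∀ (L : ℕ) [NeZero L], L₀ ≤ L → Even L →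
        ∀ ψ : Fock (Orb (FermionTorus 2 L)), star ψ ⬝ᵥ ψ = 1 →
          IsGroundStateInSector (hubbardTorus 2 L 1 0) (2 * ⌊(1 - δ) * (L : ℝ) ^ 2 / 2⌋₊) 0 ψ →
            m * (R : ℝ) ^ 2 ≤ (∑ x : TorusSite 2 L, ∑ y : TorusSite 2 L,
                  (∏ i : Fin 2, max 0 (1 - |(((y i - x i).valMinAbs : ℤ) : ℝ)| / (R : ℝ))) *
                    (star (localPair dWaveFormFactor L x *ᵥ ψ) ⬝ᵥ (localPair dWaveFormFactor L y *ᵥ ψ)).re) / (L : ℝ) ^ 2) := by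
  refine pointwise_false_of_frequently_flat_groundState ⟨50, ?_⟩
  refine Filter.frequently_atTop.2 fun L₀ => ⟨2 * (L₀ + 2), by omega, ⟨⟨by omega⟩, ⟨L₀ + 2, by ring⟩, ?_⟩⟩
  haveI : NeZero (2 * (L₀ + 2)) := ⟨by omega⟩
  obtain ⟨ψ, hψ1, hgs, hflat⟩ := exists_unit_flat_groundState_free (2 * (L₀ + 2)) (by omega)
    ⌊(1 - δ) * ((2 * (L₀ + 2) : ℕ) : ℝ) ^ 2 / 2⌋₊
    (Literature.Barriers.HubbardSuperconductivity.natFloor_filling_le_sq hδ _)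
  exact ⟨ψ, hψ1, hgs, hflat⟩

end Summit.HubbardSuperconductivity.HubbardSuperconductivity.Theorems.MesoscopicPairOrder.Negative

namespace Summit.HubbardSuperconductivity.HubbardSuperconductivity.Theorems.FunctionFieldCertificate

open Matrix Literature.Probability.LatticeModels Literature.MathematicalPhysics.QuantumLattice

/-- **Registered form** (sub-goal `interactionLoadBearing` of item `stmt-HubbardSuperconductivity-7331`,
line `Sketch`, lead c4; in the skeleton's namespace): the crux body with `U := 0` fails at every filling
`δ ≥ -1` (`MesoscopicPairOrder.Negative.pointwise_false_at_zero_coupling` as a closed proposition).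
[folklore] -/
theorem interactionLoadBearing : ∀ δ : ℝ, -1 ≤ δ →
    ¬ (∃ m : ℝ, 0 < m ∧ ∀ R₀ : ℕ, ∃ R : ℕ, R₀ ≤ R ∧ ∃ L₀ : ℕ, ∀ (L : ℕ) [NeZero L], L₀ ≤ L → Even L →
        ∀ ψ : Fock (Orb (FermionTorus 2 L)), star ψ ⬝ᵥ ψ = 1 →
          IsGroundStateInSector (hubbardTorus 2 L 1 0) (2 * ⌊(1 - δ) * (L : ℝ) ^ 2 / 2⌋₊) 0 ψ →
            m * (R : ℝ) ^ 2 ≤ (∑ x : TorusSite 2 L, ∑ y : TorusSite 2 L,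
                  (∏ i : Fin 2, max 0 (1 - |(((y i - x i).valMinAbs : ℤ) : ℝ)| / (R : ℝ))) *
                    (star (localPair dWaveFormFactor L x *ᵥ ψ) ⬝ᵥ (localPair dWaveFormFactor L y *ᵥ ψ)).re) / (L : ℝ) ^ 2) :=
  fun _ hδ => MesoscopicPairOrder.Negative.pointwise_false_at_zero_coupling hδ

end Summit.HubbardSuperconductivity.HubbardSuperconductivity.Theorems.FunctionFieldCertificate
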